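import Mathlib
import HarnessLib

/-!
# Counting square roots modulo `m`: `#{x mod m : x² ≡ D} ≤ τ(m)` for a fundamental discriminant `D`,
# hence at most `2τ(n)` reduced forms of discriminant `D` have leading coefficient `n`

Topic `Literature/NumberTheory/QuadraticFields` (namespace
`Literature.NumberTheory.QuadraticFields.SqrtModCount`). Everything in this file is PROVED (theorems only;
no definition, no named fact). Elementary number theory in the service of the cell `parity-realchar` (SIEGEL
INSTRUMENT, TARGET §2 row 16 v5: the census of reduced forms by leading coefficient feeding the class-summed
Goldfeld–Schinzel inequality; companion of `ReducedFormsLeadingCoefficients.lean`, where the census is a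
finite kernel table for `n ≤ 29`).

Write `N_D(m) = #{x ∈ [0, m) : m ∣ x² − D}` (the number of square roots of `D` modulo `m`; spelled out as a
`Finset.filter` of `Finset.range m`, no definition is introduced).

* `card_roots_mul_le` — `N_D(m₁m₂) ≤ N_D(m₁)·N_D(m₂)` for coprime `m₁, m₂` (Chinese remainder theorem:
  `x ↦ (x mod m₁, x mod m₂)` is injective on `[0, m₁m₂)`; Apostol Thm 5.28 has equality);
* `card_roots_prime_pow_le_two` — `N_D(p^k) ≤ 2` for an odd prime `p` with `p² ∤ D` (Lagrange / Hensel: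
  two roots `x, y` have `p^k ∣ (y − x)(y + x)` and `p` cannot divide both factors unless `p ∣ x`, which for
  `k ≥ 2` forces `p² ∣ D`; Apostol Thm 5.30);
* `card_roots_two_pow_le_four_of_odd` — `N_D(2^j) ≤ 4` for odd `D` (`j ≥ 1`): roots agree mod `2^{j−1}` up
  to sign; `card_roots_two_pow_eq_zero` — no roots modulo `2^j`, `j ≥ 4`, when `D = 4m`, `m ≡ 2, 3 (mod 4)`;
  `card_roots_four_le`, `card_roots_eight_le` (kernel checks);
* `card_roots_le_card_divisors` — **`N_D(m) ≤ τ(m)`** for every `m ≥ 1` when `D` is a fundamental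
  discriminant (`D ≡ 1 (mod 4)` squarefree, or `D = 4m`, `m ≡ 2, 3 (mod 4)` squarefree — the tree's spelling,
  `QuadraticFields/FundamentalDiscriminant.lean`), by induction over the coprime factorisation
  (`τ(p^k) = k + 1 ≥ 2`, `≥ 4` for `2^k`, `k ≥ 3`);
* `card_Ioc_roots_le_two_mul` — `#{b ∈ (−n, n] : 4n ∣ b² − D} ≤ 2·N_D(n)` (each residue mod `n` has at most
  two representatives in `(−n, n]`); hence `card_Ioc_roots_le_two_mul_card_divisors` —
  **`#{b ∈ (−n, n] : 4n ∣ b² − D} ≤ 2τ(n)`**, the input of the `log²`-census of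
  `Literature/NumberTheory/LFunctions/RealZeroRepulsionOddLogClassNumber.lean`.

## References

* [Apostol1976] T. M. Apostol, *Introduction to Analytic Number Theory*, Springer 1976, Thm 5.21 (Lagrange),
  Thm 5.28 (solutions of congruences with coprime moduli multiply), §5.9 Thm 5.30 (prime power moduli).
* [Cox2013] D. A. Cox, *Primes of the form x² + ny²*, §2.A (2.7), Lemma 2.5.
* [RalaivaosaonaRazakarinoro2026] Lemma 1 (`ν(p^α) = 1 + χ(p)`, the ideal-theoretic form of these counts).
-/

open Finset

namespace Literature.NumberTheory.QuadraticFields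

namespace SqrtModCount

/-! ### Congruent arguments -/

/-- `m ∣ x² − D ↔ m ∣ y² − D` when `x ≡ y (mod m)`. [folklore] -/
private theorem dvd_sq_sub_iff {m x y : ℤ} (h : x ≡ y [ZMOD m]) (D : ℤ) :
    m ∣ x ^ 2 - D ↔ m ∣ y ^ 2 - D := by
  have h2 : x ^ 2 ≡ y ^ 2 [ZMOD m] := h.pow 2
  constructor
  · intro hx
    have : y ^ 2 - D = (x ^ 2 - D) + (y ^ 2 - x ^ 2) := by ring
    rw [this]
    exact dvd_add hx (Int.ModEq.dvd h2)
  · intro hy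
    have : x ^ 2 - D = (y ^ 2 - D) + (x ^ 2 - y ^ 2) := by ring
    rw [this]
    exact dvd_add hy (Int.ModEq.dvd h2.symm)

/-- The residue `x % m` of a natural number is a root iff `x` is. [folklore] -/
private theorem dvd_mod_sq_sub_iff (m x : ℕ) (D : ℤ) :
    (m : ℤ) ∣ ((x % m : ℕ) : ℤ) ^ 2 - D ↔ (m : ℤ) ∣ (x : ℤ) ^ 2 - D := by
  refine dvd_sq_sub_iff ?_ D
  rw [Int.natCast_mod]
  exact Int.mod_modEq _ _

/-! ### Coprime moduli: `N_D(m₁m₂) ≤ N_D(m₁)N_D(m₂)` -/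

/-- **`N_D(m₁m₂) ≤ N_D(m₁)·N_D(m₂)`** for coprime `m₁, m₂`: the map `x ↦ (x mod m₁, x mod m₂)` from the roots
of `D` modulo `m₁m₂` in `[0, m₁m₂)` to pairs of roots is injective by the Chinese remainder theorem.
[cite: Apostol1976, Theorem 5.28] -/
theorem card_roots_mul_le (m₁ m₂ : ℕ) (hcop : Nat.Coprime m₁ m₂) (D : ℤ) :
    ((Finset.range (m₁ * m₂)).filter (fun x : ℕ => ((m₁ * m₂ : ℕ) : ℤ) ∣ (x : ℤ) ^ 2 - D)).card ≤
      ((Finset.range m₁).filter (fun x : ℕ => (m₁ : ℤ) ∣ (x : ℤ) ^ 2 - D)).card *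
        ((Finset.range m₂).filter (fun x : ℕ => (m₂ : ℤ) ∣ (x : ℤ) ^ 2 - D)).card := by
  classical
  rcases Nat.eq_zero_or_pos m₁ with rfl | h₁
  · simp
  rcases Nat.eq_zero_or_pos m₂ with rfl | h₂
  · simp
  rw [← Finset.card_product]
  refine Finset.card_le_card_of_injOn (fun x => (x % m₁, x % m₂)) (fun x hx => ?_) (fun x hx y hy hxy => ?_)
  · have hx' := Finset.mem_filter.mp (Finset.mem_coe.mp hx)
    obtain ⟨hxr, hdvd⟩ := hx'
    have hd1 : (m₁ : ℤ) ∣ (x : ℤ) ^ 2 - D := dvd_trans ⟨(m₂ : ℤ), by push_cast; ring⟩ hdvd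
    have hd2 : (m₂ : ℤ) ∣ (x : ℤ) ^ 2 - D := dvd_trans ⟨(m₁ : ℤ), by push_cast; ring⟩ hdvd
    refine Finset.mem_coe.mpr (Finset.mem_product.mpr ⟨Finset.mem_filter.mpr ⟨?_, ?_⟩,
      Finset.mem_filter.mpr ⟨?_, ?_⟩⟩)
    · exact Finset.mem_range.mpr (Nat.mod_lt _ h₁)
    · exact (dvd_mod_sq_sub_iff m₁ x D).mpr hd1
    · exact Finset.mem_range.mpr (Nat.mod_lt _ h₂)
    · exact (dvd_mod_sq_sub_iff m₂ x D).mpr hd2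
  · have hx' := (Finset.mem_filter.mp (Finset.mem_coe.mp hx)).1
    have hy' := (Finset.mem_filter.mp (Finset.mem_coe.mp hy)).1
    rw [Finset.mem_range] at hx' hy'
    obtain ⟨e1, e2⟩ := Prod.ext_iff.mp hxy
    have hmod : x ≡ y [MOD m₁ * m₂] := (Nat.modEq_and_modEq_iff_modEq_mul hcop).mp ⟨e1, e2⟩
    exact Nat.ModEq.eq_of_lt_of_lt hmod hx' hy'

/-! ### From residues mod `n` to representatives in `(−n, n]` -/

/-- **`#{b ∈ (−n, n] : 4n ∣ b² − D} ≤ 2·N_D(n)`**: such `b` are roots of `D` modulo `n`, and every residue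
class mod `n` has at most two representatives in `(−n, n]`. [cite: Cox2013, §2.A eq. (2.7)] -/
theorem card_Ioc_roots_le_two_mul {n : ℕ} (hn : 0 < n) (D : ℤ) :
    ((Finset.Ioc (-(n : ℤ)) n).filter (fun b => (4 * n : ℤ) ∣ b ^ 2 - D)).card ≤
      2 * ((Finset.range n).filter (fun x : ℕ => (n : ℤ) ∣ (x : ℤ) ^ 2 - D)).card := by
  classical
  set s := (Finset.Ioc (-(n : ℤ)) n).filter (fun b => (n : ℤ) ∣ b ^ 2 - D) with hs
  have hsub : (Finset.Ioc (-(n : ℤ)) n).filter (fun b => (4 * n : ℤ) ∣ b ^ 2 - D) ⊆ s := by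
    intro b hb
    rw [Finset.mem_filter] at hb ⊢
    exact ⟨hb.1, dvd_trans ⟨4, by ring⟩ hb.2⟩
  refine (Finset.card_le_card hsub).trans ?_
  -- the residue map and its fibres
  have hnZ : (0 : ℤ) < n := by exact_mod_cast hn
  set f : ℤ → ℕ := fun b => (b % n).toNat with hf
  have hfib : ∀ a ∈ s.image f, (s.filter (fun b => f b = a)).card ≤ 2 := by
    intro a _
    -- every `b ∈ (−n, n]` with `b % n = a` is `a` or `a − n` or `a + n`, and at most two of these fit
    have hsub2 : s.filter (fun b => f b = a) ⊆ {(a : ℤ), (a : ℤ) - n, (a : ℤ) + n} := by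
      intro b hb
      rw [Finset.mem_filter] at hb
      obtain ⟨hbs, hba⟩ := hb
      rw [hs, Finset.mem_filter, Finset.mem_Ioc] at hbs
      obtain ⟨⟨hb1, hb2⟩, -⟩ := hbs
      have hr0 : 0 ≤ b % n := Int.emod_nonneg _ hnZ.ne'
      have hrn : b % n < n := Int.emod_lt_of_pos _ hnZ
      have hba' : b % n = a := by
        rw [hf] at hba; simp only at hba
        rw [← hba, Int.toNat_of_nonneg hr0]
      have hdec := Int.emod_add_ediv_mul b n   -- b % n + b / n * n = b
      set q := b / n with hq
      have hq1 : -2 < q := by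
        by_contra hcon
        push Not at hcon
        have : q * (n : ℤ) ≤ -2 * n := by nlinarith
        linarith
      have hq2 : q ≤ 1 := by
        by_contra hcon
        push Not at hcon
        have : 2 * (n : ℤ) ≤ q * n := by nlinarith
        linarith
      simp only [Finset.mem_insert, Finset.mem_singleton]
      interval_cases q
      · right; left; linarith
      · left; linarith
      · right; right; linarith
    -- but `a − n` and `a + n` cannot both lie in `(−n, n]`
    by_cases ha0 : a = 0
    · -- then `a − n = −n ∉ (−n, n]`
      have hsub3 : s.filter (fun b => f b = a) ⊆ {(a : ℤ), (a : ℤ) + n} := by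
        intro b hb
        have hb3 := hsub2 hb
        rw [Finset.mem_filter, hs, Finset.mem_filter, Finset.mem_Ioc] at hb
        simp only [Finset.mem_insert, Finset.mem_singleton] at hb3 ⊢
        rcases hb3 with h | h | h
        · exact Or.inl h
        · exfalso; rw [ha0] at h; push_cast at h; linarith [hb.1.1.1]
        · exact Or.inr h
      exact (Finset.card_le_card hsub3).trans (Finset.card_le_two)
    · -- then `a + n > n`
      have ha1 : (1 : ℤ) ≤ a := by
        have : 0 < a := Nat.pos_of_ne_zero ha0
        exact_mod_cast this
      have hsub3 : s.filter (fun b => f b = a) ⊆ {(a : ℤ), (a : ℤ) - n} := by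
        intro b hb
        have hb3 := hsub2 hb
        rw [Finset.mem_filter, hs, Finset.mem_filter, Finset.mem_Ioc] at hb
        simp only [Finset.mem_insert, Finset.mem_singleton] at hb3 ⊢
        rcases hb3 with h | h | h
        · exact Or.inl h
        · exact Or.inr h
        · exfalso; linarith [hb.1.1.2]
      exact (Finset.card_le_card hsub3).trans (Finset.card_le_two)
  have hmul := Finset.card_le_mul_card_image s 2 hfib
  -- the image consists of roots mod `n` in `[0, n)`
  have himg : s.image f ⊆ (Finset.range n).filter (fun x : ℕ => (n : ℤ) ∣ (x : ℤ) ^ 2 - D) := by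
    intro a ha
    rw [Finset.mem_image] at ha
    obtain ⟨b, hb, rfl⟩ := ha
    rw [hs, Finset.mem_filter] at hb
    have hr0 : 0 ≤ b % n := Int.emod_nonneg _ hnZ.ne'
    have hrn : b % n < n := Int.emod_lt_of_pos _ hnZ
    rw [Finset.mem_filter, Finset.mem_range]
    refine ⟨?_, ?_⟩
    · have : ((b % n).toNat : ℤ) < n := by rw [Int.toNat_of_nonneg hr0]; exact hrn
      exact_mod_cast this
    · rw [hf]; simp only
      rw [Int.toNat_of_nonneg hr0]
      exact (dvd_sq_sub_iff (Int.mod_modEq b n) D).mpr hb.2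
  exact hmul.trans (Nat.mul_le_mul_left 2 (Finset.card_le_card himg))

/-! ### Residues only; the moduli `4` and `8` by evaluation -/

/-- The root count mod `m` depends on `D mod m` only: a bound checked on the residues holds for every `D`.
[folklore] -/
private theorem card_roots_le_of_forall_fin {m R : ℕ} (hm : 0 < m)
    (h : ∀ r : Fin m, ((Finset.range m).filter (fun x : ℕ => (m : ℤ) ∣ (x : ℤ) ^ 2 - ((r : ℕ) : ℤ))).card ≤ R)
    (D : ℤ) : ((Finset.range m).filter (fun x : ℕ => (m : ℤ) ∣ (x : ℤ) ^ 2 - D)).card ≤ R := by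
  have hm0 : (0 : ℤ) < m := by exact_mod_cast hm
  have hr0 : 0 ≤ D % m := Int.emod_nonneg _ hm0.ne'
  have hrm : D % m < m := Int.emod_lt_of_pos _ hm0
  have hlt : (D % m).toNat < m := by
    have : ((D % m).toNat : ℤ) < m := by rw [Int.toNat_of_nonneg hr0]; exact hrm
    exact_mod_cast this
  have key := h ⟨(D % m).toNat, hlt⟩
  have hcast : (((⟨(D % m).toNat, hlt⟩ : Fin m) : ℕ) : ℤ) = D % m := Int.toNat_of_nonneg hr0
  rw [hcast] at key
  have hset : (Finset.range m).filter (fun x : ℕ => (m : ℤ) ∣ (x : ℤ) ^ 2 - D) =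
      (Finset.range m).filter (fun x : ℕ => (m : ℤ) ∣ (x : ℤ) ^ 2 - D % m) := by
    refine Finset.filter_congr fun x _ => ?_
    have e : (x : ℤ) ^ 2 - D % m = ((x : ℤ) ^ 2 - D) + m * (D / m) := by
      have := Int.emod_add_ediv_mul D m
      linarith [mul_comm (D / m) (m : ℤ)]
    rw [e, dvd_add_left (dvd_mul_right (m : ℤ) (D / m))]
  rw [hset]
  exact key

/-- `N_D(4) ≤ 2` for every `D` (kernel check on the four residues). [cite: Apostol1976, Theorem 5.30] -/
theorem card_roots_four_le (D : ℤ) :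
    ((Finset.range 4).filter (fun x : ℕ => ((4 : ℕ) : ℤ) ∣ (x : ℤ) ^ 2 - D)).card ≤ 2 :=
  card_roots_le_of_forall_fin (m := 4) (by norm_num) (by decide) D

/-- `N_D(8) ≤ 4` for every `D` (kernel check on the eight residues). [cite: Apostol1976, Theorem 5.30] -/
theorem card_roots_eight_le (D : ℤ) :
    ((Finset.range 8).filter (fun x : ℕ => ((8 : ℕ) : ℤ) ∣ (x : ℤ) ^ 2 - D)).card ≤ 4 :=
  card_roots_le_of_forall_fin (m := 8) (by norm_num) (by decide) D

/-! ### Odd prime powers: at most two roots -/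

/-- **`N_D(p^k) ≤ 2` for an odd prime `p` with `p² ∤ D`** (`k ≥ 1`): two roots `x₀, y` satisfy
`p^k ∣ (y + x₀)(y − x₀)`; if `p` divides both factors it divides `y` and `x₀`, which for `k ≥ 2` forces
`p² ∣ D` and for `k = 1` forces `y = x₀ = 0`; otherwise `p^k` divides one factor, so `y ≡ ±x₀`.
[cite: Apostol1976, Theorem 5.30] -/
theorem card_roots_prime_pow_le_two {p : ℕ} (hp : p.Prime) (hp2 : p ≠ 2) {k : ℕ} (hk : 0 < k) {D : ℤ}
    (hD : ¬ ((p : ℤ) ^ 2 ∣ D)) :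
    ((Finset.range (p ^ k)).filter (fun x : ℕ => ((p ^ k : ℕ) : ℤ) ∣ (x : ℤ) ^ 2 - D)).card ≤ 2 := by
  classical
  set s := (Finset.range (p ^ k)).filter (fun x : ℕ => ((p ^ k : ℕ) : ℤ) ∣ (x : ℤ) ^ 2 - D) with hs
  rcases s.eq_empty_or_nonempty with h0 | ⟨x₀, hx₀⟩
  · rw [h0]; simp
  obtain ⟨hx₀r, hx₀d⟩ := Finset.mem_filter.mp hx₀
  rw [Finset.mem_range] at hx₀r
  have hPZ : ((p ^ k : ℕ) : ℤ) = (p : ℤ) ^ k := by push_cast; ring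
  have hP0 : 0 < p ^ k := pow_pos hp.pos k
  have hpZ : Prime (p : ℤ) := Nat.prime_iff_prime_int.mp hp
  have hp2Z : ¬ ((p : ℤ) ∣ 2) := by
    intro h
    have h2 : (p : ℤ) ≤ 2 := Int.le_of_dvd two_pos h
    have := hp.two_le
    have : p = 2 := by omega
    exact hp2 this
  have hsub : s ⊆ {x₀, (p ^ k - x₀) % p ^ k} := by
    intro y hy
    obtain ⟨hyr, hyd⟩ := Finset.mem_filter.mp hy
    rw [Finset.mem_range] at hyr
    simp only [Finset.mem_insert, Finset.mem_singleton]
    have hprod : (p : ℤ) ^ k ∣ ((y : ℤ) + x₀) * ((y : ℤ) - x₀) := by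
      have e : ((y : ℤ) + x₀) * ((y : ℤ) - x₀) = ((y : ℤ) ^ 2 - D) - ((x₀ : ℤ) ^ 2 - D) := by ring
      rw [e, ← hPZ]; exact dvd_sub hyd hx₀d
    by_cases h1 : (p : ℤ) ∣ (y : ℤ) - x₀
    · by_cases h2 : (p : ℤ) ∣ (y : ℤ) + x₀
      · -- `p ∣ 2y`, so `p ∣ y` and `p ∣ x₀`
        have h2y : (p : ℤ) ∣ 2 * (y : ℤ) := by
          have := dvd_add h1 h2
          rwa [show ((y : ℤ) - x₀) + ((y : ℤ) + x₀) = 2 * y by ring] at this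
        have hpy : (p : ℤ) ∣ (y : ℤ) := (hpZ.dvd_or_dvd h2y).resolve_left hp2Z
        have hpx : (p : ℤ) ∣ (x₀ : ℤ) := by
          have := dvd_sub hpy h1
          rwa [show (y : ℤ) - ((y : ℤ) - x₀) = x₀ by ring] at this
        rcases Nat.lt_or_ge k 2 with hk1 | hk2
        · -- `k = 1`: `y = x₀ = 0`
          have hk1' : k = 1 := by omega
          subst hk1'
          have hy0 : y = 0 := Nat.eq_zero_of_dvd_of_lt (Int.natCast_dvd_natCast.mp hpy) (by simpa using hyr)
          have hx0 : x₀ = 0 := Nat.eq_zero_of_dvd_of_lt (Int.natCast_dvd_natCast.mp hpx) (by simpa using hx₀r)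
          left; rw [hy0, hx0]
        · -- `k ≥ 2`: `p² ∣ y²` and `p² ∣ p^k ∣ y² − D` give `p² ∣ D`
          exfalso
          have hp2y : (p : ℤ) ^ 2 ∣ (y : ℤ) ^ 2 := pow_dvd_pow_of_dvd hpy 2
          have hp2P : (p : ℤ) ^ 2 ∣ (p : ℤ) ^ k := pow_dvd_pow _ hk2
          have hp2d : (p : ℤ) ^ 2 ∣ (y : ℤ) ^ 2 - D := dvd_trans hp2P (by rw [← hPZ]; exact hyd)
          have := dvd_sub hp2y hp2d
          rw [show (y : ℤ) ^ 2 - ((y : ℤ) ^ 2 - D) = D by ring] at this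
          exact hD this
      · -- `p ∤ y + x₀`: `p^k ∣ y − x₀`, so `y = x₀`
        have hcop : IsCoprime ((p : ℤ) ^ k) ((y : ℤ) + x₀) :=
          ((Prime.coprime_iff_not_dvd hpZ).mpr h2).pow_left
        have hd : (p : ℤ) ^ k ∣ (y : ℤ) - x₀ := hcop.dvd_of_dvd_mul_left hprod
        have hPk : (0 : ℤ) < (p : ℤ) ^ k := pow_pos (by exact_mod_cast hp.pos) k
        have hyZ : ((y : ℕ) : ℤ) < (p : ℤ) ^ k := by rw [← hPZ]; exact_mod_cast hyr
        have hxZ : ((x₀ : ℕ) : ℤ) < (p : ℤ) ^ k := by rw [← hPZ]; exact_mod_cast hx₀r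
        have h0 : (y : ℤ) - x₀ = 0 := by
          refine Int.eq_zero_of_abs_lt_dvd hd ?_
          rw [abs_sub_lt_iff]; constructor <;> linarith
        left; exact_mod_cast (by linarith : (y : ℤ) = x₀)
    · -- `p ∤ y − x₀`: `p^k ∣ y + x₀`, so `y + x₀ ∈ {0, p^k}`
      have hcop : IsCoprime ((p : ℤ) ^ k) ((y : ℤ) - x₀) :=
        ((Prime.coprime_iff_not_dvd hpZ).mpr h1).pow_left
      have hd : (p : ℤ) ^ k ∣ (y : ℤ) + x₀ := hcop.dvd_of_dvd_mul_right hprod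
      obtain ⟨c, hc⟩ := hd
      have hPk : (0 : ℤ) < (p : ℤ) ^ k := pow_pos (by exact_mod_cast hp.pos) k
      have hyZ : ((y : ℕ) : ℤ) < (p : ℤ) ^ k := by rw [← hPZ]; exact_mod_cast hyr
      have hxZ : ((x₀ : ℕ) : ℤ) < (p : ℤ) ^ k := by rw [← hPZ]; exact_mod_cast hx₀r
      have hc0 : 0 ≤ c := by
        by_contra hcon; push Not at hcon
        have : (p : ℤ) ^ k * c ≤ (p : ℤ) ^ k * (-1) := by nlinarith
        have : (0 : ℤ) ≤ (y : ℤ) + x₀ := by positivity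
        linarith
      have hc1 : c ≤ 1 := by
        by_contra hcon; push Not at hcon
        have : (p : ℤ) ^ k * 2 ≤ (p : ℤ) ^ k * c := by nlinarith
        linarith
      interval_cases c
      · -- `y + x₀ = 0`: `y = x₀ = 0`
        left
        have : (y : ℤ) = 0 ∧ (x₀ : ℤ) = 0 := by
          constructor <;> linarith [(by positivity : (0 : ℤ) ≤ (y : ℤ)), (by positivity : (0 : ℤ) ≤ (x₀ : ℤ))]
        have hy0 : y = 0 := by exact_mod_cast this.1
        have hx0 : x₀ = 0 := by exact_mod_cast this.2
        rw [hy0, hx0]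
      · right
        have hx1 : 1 ≤ x₀ := by
          by_contra hcon; push Not at hcon
          have : x₀ = 0 := by omega
          subst this
          simp at hc; linarith
        have hyeq : (y : ℤ) = (p : ℤ) ^ k - x₀ := by linarith
        have hyN : y = p ^ k - x₀ := by
          have : ((p ^ k - x₀ : ℕ) : ℤ) = (p : ℤ) ^ k - x₀ := by
            rw [Nat.cast_sub hx₀r.le]; push_cast; ring
          exact_mod_cast (hyeq.trans this.symm)
        rw [hyN, Nat.mod_eq_of_lt (by omega)]
  exact (Finset.card_le_card hsub).trans Finset.card_le_two

/-! ### Powers of two -/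

/-- **`N_D(2^j) ≤ 4` for odd `D`** (`j ≥ 2`): two odd roots `x₀, y` have `2^j ∣ (y − x₀)(y + x₀)` with exactly
one of the two (even) factors `≡ 2 (mod 4)`, so `2^{j−1}` divides the other: `y ≡ ±x₀ (mod 2^{j−1})`, and
each residue mod `2^{j−1}` has two representatives in `[0, 2^j)`. [cite: Apostol1976, Theorem 5.30] -/
theorem card_roots_two_pow_le_four_of_odd {j : ℕ} (hj : 2 ≤ j) {D : ℤ} (hD : Odd D) :
    ((Finset.range (2 ^ j)).filter (fun x : ℕ => ((2 ^ j : ℕ) : ℤ) ∣ (x : ℤ) ^ 2 - D)).card ≤ 4 := by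
  classical
  set s := (Finset.range (2 ^ j)).filter (fun x : ℕ => ((2 ^ j : ℕ) : ℤ) ∣ (x : ℤ) ^ 2 - D) with hs
  rcases s.eq_empty_or_nonempty with h0 | ⟨x₀, hx₀⟩
  · rw [h0]; simp
  obtain ⟨hx₀r, hx₀d⟩ := Finset.mem_filter.mp hx₀
  rw [Finset.mem_range] at hx₀r
  set M : ℕ := 2 ^ (j - 1) with hM
  have hjM : 2 ^ j = 2 * M := by
    rw [hM, ← pow_succ']; congr 1; omega
  have hM0 : 0 < M := by rw [hM]; positivity
  have hPZ : ((2 ^ j : ℕ) : ℤ) = 2 * (M : ℤ) := by rw [hjM]; push_cast; ring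
  -- roots are odd
  have hodd : ∀ y : ℕ, ((2 ^ j : ℕ) : ℤ) ∣ (y : ℤ) ^ 2 - D → Odd (y : ℤ) := by
    intro y hy
    have h2 : (2 : ℤ) ∣ (y : ℤ) ^ 2 - D := dvd_trans ⟨(M : ℤ), hPZ⟩ hy
    have hsq : Odd ((y : ℤ) ^ 2) := by
      have : (y : ℤ) ^ 2 = D + ((y : ℤ) ^ 2 - D) := by ring
      rw [this]
      exact hD.add_even (even_iff_two_dvd.mpr h2)
    exact (Int.odd_pow' two_ne_zero).mp hsq
  have hx₀odd := hodd x₀ hx₀d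
  -- key: every root is `≡ x₀` or `≡ −x₀ (mod M)`
  set f : ℕ → ℕ := fun y => y % M with hf
  have himg : s.image f ⊆ {x₀ % M, (2 ^ j - x₀) % M} := by
    intro a ha
    rw [Finset.mem_image] at ha
    obtain ⟨y, hy, rfl⟩ := ha
    obtain ⟨hyr, hyd⟩ := Finset.mem_filter.mp hy
    rw [Finset.mem_range] at hyr
    have hyodd := hodd y hyd
    simp only [Finset.mem_insert, Finset.mem_singleton, hf]
    -- `2M ∣ A·B`, `A = y − x₀`, `B = y + x₀`, both even, not both `≡ 0 (mod 4)`
    have hprod : 2 * (M : ℤ) ∣ ((y : ℤ) - x₀) * ((y : ℤ) + x₀) := by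
      have e : ((y : ℤ) - x₀) * ((y : ℤ) + x₀) = ((y : ℤ) ^ 2 - D) - ((x₀ : ℤ) ^ 2 - D) := by ring
      rw [e, ← hPZ]; exact dvd_sub hyd hx₀d
    obtain ⟨u, hu⟩ := hyodd      -- y = 2u+1
    obtain ⟨v, hv⟩ := hx₀odd     -- x₀ = 2v+1
    have hA : (y : ℤ) - x₀ = 2 * (u - v) := by rw [hu, hv]; ring
    have hB : (y : ℤ) + x₀ = 2 * (u + v + 1) := by rw [hu, hv]; ring
    -- one of `u − v`, `u + v + 1` is odd
    have hM2 : (M : ℤ) ∣ 2 * ((u - v) * (u + v + 1)) := by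
      have : 2 * (M : ℤ) ∣ 2 * (2 * ((u - v) * (u + v + 1))) := by
        rw [hA, hB] at hprod
        rwa [show 2 * (u - v) * (2 * (u + v + 1)) = 2 * (2 * ((u - v) * (u + v + 1))) by ring] at hprod
      exact (mul_dvd_mul_iff_left two_ne_zero).mp this
    have h2prime : Prime (2 : ℤ) := Int.prime_two
    rcases Int.even_or_odd (u - v) with heven | hoddA
    · -- `u − v` even ⇒ `u + v + 1` odd ⇒ `M ∣ 2(u − v)·… ` hmm: `M ∣ (u+v+1) * (2(u−v))` with `u+v+1` odd coprime to `M`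
      have hBodd : Odd (u + v + 1) := by
        obtain ⟨w, hw⟩ := heven
        exact ⟨u - w, by linarith⟩
      have hcop : IsCoprime ((2 : ℤ) ^ (j - 1)) (u + v + 1) := by
        refine IsCoprime.pow_left ((Prime.coprime_iff_not_dvd h2prime).mpr ?_)
        rw [← even_iff_two_dvd]; exact Int.not_even_iff_odd.mpr hBodd
      have hMZ : (M : ℤ) = (2 : ℤ) ^ (j - 1) := by rw [hM]; push_cast; ring
      have hdvdA : (M : ℤ) ∣ 2 * (u - v) := by
        rw [hMZ] at hM2 ⊢
        exact hcop.dvd_of_dvd_mul_right (by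
          rwa [show 2 * ((u - v) * (u + v + 1)) = (2 * (u - v)) * (u + v + 1) by ring] at hM2)
      -- `y ≡ x₀ (mod M)`
      left
      have hmod : (y : ℤ) ≡ x₀ [ZMOD M] := by
        rw [Int.modEq_iff_dvd]
        rw [show (x₀ : ℤ) - y = -(2 * (u - v)) by rw [hu, hv]; ring]
        exact (dvd_neg).mpr hdvdA
      have := hmod  -- y % M = x₀ % M in ℤ
      unfold Int.ModEq at this
      have e1 : ((y % M : ℕ) : ℤ) = ((x₀ % M : ℕ) : ℤ) := by
        rw [Int.natCast_mod, Int.natCast_mod]; exact this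
      exact_mod_cast e1
    · -- `u − v` odd ⇒ `M ∣ 2(u+v+1)` ⇒ `y ≡ −x₀ ≡ 2^j − x₀ (mod M)`
      have hcop : IsCoprime ((2 : ℤ) ^ (j - 1)) (u - v) := by
        refine IsCoprime.pow_left ((Prime.coprime_iff_not_dvd h2prime).mpr ?_)
        rw [← even_iff_two_dvd]; exact Int.not_even_iff_odd.mpr hoddA
      have hMZ : (M : ℤ) = (2 : ℤ) ^ (j - 1) := by rw [hM]; push_cast; ring
      have hdvdB : (M : ℤ) ∣ 2 * (u + v + 1) := by
        rw [hMZ] at hM2 ⊢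
        exact hcop.dvd_of_dvd_mul_left (by
          rwa [show 2 * ((u - v) * (u + v + 1)) = (u - v) * (2 * (u + v + 1)) by ring] at hM2)
      right
      have hmod : (y : ℤ) ≡ ((2 ^ j - x₀ : ℕ) : ℤ) [ZMOD M] := by
        rw [Nat.cast_sub hx₀r.le, hPZ, Int.modEq_iff_dvd]
        rw [show 2 * (M : ℤ) - x₀ - y = -(2 * (u + v + 1)) + (M : ℤ) * 2 by rw [hu, hv]; ring]
        exact dvd_add ((dvd_neg).mpr hdvdB) (dvd_mul_right _ _)
      unfold Int.ModEq at hmod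
      have e1 : ((y % M : ℕ) : ℤ) = (((2 ^ j - x₀) % M : ℕ) : ℤ) := by
        rw [Int.natCast_mod, Int.natCast_mod]; exact hmod
      exact_mod_cast e1
  -- fibres of `y ↦ y % M` on `[0, 2M)` have at most two elements
  have hfib : ∀ a ∈ s.image f, (s.filter (fun y => f y = a)).card ≤ 2 := by
    intro a ha
    have hsub2 : s.filter (fun y => f y = a) ⊆ {a, a + M} := by
      intro y hy
      rw [Finset.mem_filter] at hy
      obtain ⟨hys, hya⟩ := hy
      obtain ⟨hyr, -⟩ := Finset.mem_filter.mp hys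
      rw [Finset.mem_range, hjM] at hyr
      simp only [hf] at hya
      simp only [Finset.mem_insert, Finset.mem_singleton]
      have hdec := Nat.mod_add_div y M   -- y % M + M * (y / M) = y
      have hq : y / M < 2 := by
        rw [Nat.div_lt_iff_lt_mul hM0]; linarith
      interval_cases hq' : y / M
      · left; omega
      · right; omega
    exact (Finset.card_le_card hsub2).trans Finset.card_le_two
  have hmul := Finset.card_le_mul_card_image s 2 hfib
  have h2 : (s.image f).card ≤ 2 := (Finset.card_le_card himg).trans Finset.card_le_two
  calc s.card ≤ 2 * (s.image f).card := hmul
    _ ≤ 2 * 2 := Nat.mul_le_mul_left 2 h2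
    _ = 4 := by norm_num

/-- **No roots modulo `2^j` (`j ≥ 4`) when `D = 4m` with `m ≡ 2, 3 (mod 4)`**: a root `x` is even, `x = 2z`,
and `z² ≡ m (mod 4)` is impossible. [cite: Apostol1976, Theorem 5.30] -/
theorem card_roots_two_pow_eq_zero {j : ℕ} (hj : 4 ≤ j) {D : ℤ} (h4 : 4 ∣ D)
    (hm : D / 4 % 4 = 2 ∨ D / 4 % 4 = 3) :
    ((Finset.range (2 ^ j)).filter (fun x : ℕ => ((2 ^ j : ℕ) : ℤ) ∣ (x : ℤ) ^ 2 - D)).card = 0 := by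
  rw [Finset.card_eq_zero, Finset.filter_eq_empty_iff]
  intro x _ hx
  obtain ⟨m, hmD⟩ := h4
  have hm' : m % 4 = 2 ∨ m % 4 = 3 := by
    rw [hmD, Int.mul_ediv_cancel_left _ (by norm_num : (4 : ℤ) ≠ 0)] at hm; exact hm
  have h16 : (16 : ℤ) ∣ (x : ℤ) ^ 2 - D := by
    refine dvd_trans ?_ hx
    refine ⟨((2 ^ (j - 4) : ℕ) : ℤ), ?_⟩
    rw [show ((2 ^ j : ℕ) : ℤ) = ((2 ^ 4 * 2 ^ (j - 4) : ℕ) : ℤ) by rw [← pow_add]; congr 2; omega]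
    push_cast; ring
  -- `x` is even
  have hxeven : Even (x : ℤ) := by
    by_contra hxo
    rw [Int.not_even_iff_odd] at hxo
    have h1 := Int.sq_mod_four_eq_one_of_odd hxo
    have h4' : (4 : ℤ) ∣ (x : ℤ) ^ 2 - D := dvd_trans ⟨4, by norm_num⟩ h16
    omega
  obtain ⟨z, hz⟩ := hxeven
  -- `16 ∣ 4z² − 4m` ⇒ `4 ∣ z² − m`
  have h4z : (4 : ℤ) ∣ z ^ 2 - m := by
    have : (x : ℤ) ^ 2 - D = 4 * (z ^ 2 - m) := by rw [hz, hmD]; ring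
    rw [this, show (16 : ℤ) = 4 * 4 by norm_num] at h16
    exact (mul_dvd_mul_iff_left (by norm_num : (4 : ℤ) ≠ 0)).mp h16
  -- squares are `0, 1 (mod 4)`
  rcases Int.even_or_odd z with ⟨w, hw⟩ | hzo
  · have : (4 : ℤ) ∣ z ^ 2 := ⟨w ^ 2, by rw [hw]; ring⟩
    omega
  · have := Int.sq_mod_four_eq_one_of_odd hzo
    omega

/-! ### Assembly: `N_D(m) ≤ τ(m)` for a fundamental discriminant `D` -/

/-- For a fundamental discriminant and an odd prime `p`: `p² ∤ D`. [folklore] -/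
private theorem not_sq_dvd_of_fundamental {D : ℤ}
    (hD : (D % 4 = 1 ∧ Squarefree D) ∨ (4 ∣ D ∧ (D / 4 % 4 = 2 ∨ D / 4 % 4 = 3) ∧ Squarefree (D / 4)))
    {p : ℕ} (hp : p.Prime) (hp2 : p ≠ 2) : ¬ ((p : ℤ) ^ 2 ∣ D) := by
  intro hsq
  have hpu : ¬ IsUnit (p : ℤ) := by
    rw [Int.isUnit_iff]; have := hp.two_le; omega
  rcases hD with ⟨-, hsf⟩ | ⟨h4, -, hsf⟩
  · exact hpu (hsf p (by rw [← sq]; exact hsq))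
  · -- `p² ∣ 4·(D/4)` with `p` odd ⇒ `p² ∣ D/4`
    have hD4 : D = 4 * (D / 4) := by rw [Int.mul_ediv_cancel' h4]
    have hcopN : Nat.Coprime (p ^ 2) 4 := by
      have : Nat.Coprime p 2 := (Nat.coprime_primes hp Nat.prime_two).mpr hp2
      simpa using (this.pow 2 2)
    have hcop : IsCoprime ((p : ℤ) ^ 2) (4 : ℤ) := by
      have := Nat.isCoprime_iff_coprime.mpr hcopN
      push_cast at this; exact this
    have hsq' : (p : ℤ) ^ 2 ∣ 4 * (D / 4) := by rw [← hD4]; exact hsq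
    have hdiv : (p : ℤ) ^ 2 ∣ D / 4 := hcop.dvd_of_dvd_mul_left hsq'
    exact hpu (hsf p (by rw [← sq]; exact hdiv))

/-- **`N_D(m) ≤ τ(m)` for every `m` and every fundamental discriminant `D`** (`D ≡ 1 (mod 4)` squarefree, or
`D = 4m'` with `m' ≡ 2, 3 (mod 4)` squarefree): induction over the coprime factorisation with
`N_D(p^k) ≤ 2 ≤ k + 1` (`p` odd), `N_D(2^k) ≤ min(2^k, 4)`, `= 0` for `k ≥ 4` in the even case.
[cite: Apostol1976, Theorem 5.28] -/
theorem card_roots_le_card_divisors {D : ℤ}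
    (hD : (D % 4 = 1 ∧ Squarefree D) ∨ (4 ∣ D ∧ (D / 4 % 4 = 2 ∨ D / 4 % 4 = 3) ∧ Squarefree (D / 4)))
    (m : ℕ) :
    ((Finset.range m).filter (fun x : ℕ => (m : ℤ) ∣ (x : ℤ) ^ 2 - D)).card ≤ m.divisors.card := by
  classical
  induction m using Nat.recOnPosPrimePosCoprime with
  | prime_pow p n hp hn =>
    rw [← ArithmeticFunction.sigma_zero_apply, ArithmeticFunction.sigma_zero_apply_prime_pow hp]
    by_cases hp2 : p = 2
    · subst hp2
      rcases Nat.lt_or_ge n 4 with hn4 | hn4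
      · interval_cases n
        · -- `2¹`: at most the two residues
          calc _ ≤ (Finset.range (2 ^ 1)).card := Finset.card_filter_le _ _
            _ = 1 + 1 := by simp
        · exact (card_roots_four_le D).trans (by norm_num)
        · exact (card_roots_eight_le D).trans (by norm_num)
      · rcases hD with ⟨h1, -⟩ | ⟨h4, hm, -⟩
        · have hodd : Odd D := Int.odd_iff.mpr (by omega)
          exact (card_roots_two_pow_le_four_of_odd (by omega) hodd).trans (by omega)
        · rw [card_roots_two_pow_eq_zero hn4 h4 hm]; omega
    · exact (card_roots_prime_pow_le_two hp hp2 hn (not_sq_dvd_of_fundamental hD hp hp2)).trans (by omega)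
  | zero => simp
  | one =>
    calc _ ≤ (Finset.range 1).card := Finset.card_filter_le _ _
      _ = (Nat.divisors 1).card := by simp
  | coprime a b ha hb hcop iha ihb =>
    rw [Nat.Coprime.card_divisors_mul hcop]
    exact (card_roots_mul_le a b hcop D).trans (Nat.mul_le_mul iha ihb)

/-- **At most `2τ(n)` values `b ∈ (−n, n]` with `4n ∣ b² − D`** for a fundamental discriminant `D` and `n ≥ 1`;
with `ReducedFormsLeadingCoefficients.card_filter_fst_eq_le`, at most `2τ(n)` reduced forms of discriminant `D`
have leading coefficient `n` (Ralaivaosaona–Razakarinoro's `ν(a) ≤ 2^{ω(a)}`, up to the factor `2` and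
`2^ω ≤ τ`). [cite: RalaivaosaonaRazakarinoro2026, Lemma 1] [cite: Apostol1976, Theorem 5.28] -/
theorem card_Ioc_roots_le_two_mul_card_divisors {D : ℤ}
    (hD : (D % 4 = 1 ∧ Squarefree D) ∨ (4 ∣ D ∧ (D / 4 % 4 = 2 ∨ D / 4 % 4 = 3) ∧ Squarefree (D / 4)))
    {n : ℕ} (hn : 0 < n) :
    ((Finset.Ioc (-(n : ℤ)) n).filter (fun b => (4 * n : ℤ) ∣ b ^ 2 - D)).card ≤ 2 * n.divisors.card :=
  (card_Ioc_roots_le_two_mul hn D).trans (Nat.mul_le_mul_left 2 (card_roots_le_card_divisors hD n))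

end SqrtModCount

end Literature.NumberTheory.QuadraticFields
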